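import Mathlib
import Literature.Probability.RandomPlanarGeometry.HexParafermion
import Literature.Probability.RandomPlanarGeometry.HexParafermionProofs
import Literature.Probability.RandomPlanarGeometry.HexParafermionTransport
import Literature.Probability.RandomPlanarGeometry.HexSAWLattice
import Literature.Probability.RandomPlanarGeometry.HexSAWPathRigidity
import Literature.Probability.RandomPlanarGeometry.SAWEdgeListSurgery
import Summits.CriticalPhenomena.SAWScalingLimit.Theorems.SAWDefectDecoherenceMassRatioRenewalDictionaryB

/-!
# Explicit self-avoiding walks between boundary mid-edges from coordinate data, and their windings

Crux `NoFoldBound` (stmt-CriticalPhenomena-8296), negative side: support file for the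
BOUNDARY-IDENTITY RAY (`BoundaryRay*.lean`): a finite simply connected domain on which the complete
family of Duminil-Copin–Smirnov boundary identities, with positivity and rigid phases, admits an
unbounded nonnegative solution. The ray is certified walk by walk; this file is the tool that turns a
list of coordinates into a `HexMidEdgeSAW` together with the VALUE of its winding.

* `exists_walk` — for a domain `Ω` whose coordinate image is `ΩHV` (`HV = ℤ × ℤ × Bool`,
  `HexSAWLattice.lean`) and coordinate data `(ob, P, om)` satisfying the decidable side conditions
  (`P` nonempty and duplicate-free, `ob :: P ++ [om]` a chain of `hvGraph`, `P ⊆ ΩHV`, the two door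
  vertices `ob`, `om` outside, `ob ≠ om` when `P` is a single vertex), there is a walk
  `γ : HexMidEdgeSAW Ω {ob, head P} {last P, om}` with `γ.verts = P.map ofHV` and
  **`γ.winding = (π/3) · HV.pturn (ob :: P ++ [om])`** (the winding is the winding of the lattice path
  through the far ends of the two mid-edges, `HexMidEdgeSAW.winding_eq_winding_map`; the coordinate
  model is the honeycomb scaled by `3`, `emb_pos_toHV`; and the winding of an embedded chain without
  backtracking is `(π/3)·pturn`, `winding_map_emb_pos`);
* `nodup_edges_cons_concat` — the half-edges `{ob, v₁}, {v₁,v₂}, …, {vₙ, om}` are pairwise distinct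
  as soon as `ob ∉ P ∌ om`, `P` is duplicate-free and `ob ≠ om` if `n = 1` (the returning loop around
  a vertex has `ob = om`).

Sources: H. Duminil-Copin, S. Smirnov, *The connective constant of the honeycomb lattice equals
`√(2+√2)`*, Ann. of Math. 175 (2012), §2 (walks between mid-edges, winding). Sorry-free.
-/

noncomputable section

open Literature.Probability.LatticeModels Literature.Probability.RandomPlanarGeometry.SAW
open Summit.CriticalPhenomena.SAWScalingLimit.Theorems.MassRatio.Renewal.BridgeDictionary (ofHV_injective)

namespace Summit.CriticalPhenomena.SAWScalingLimit.Theorems.NoFoldBound.Negative.BoundaryRay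

/-- Adjacency of `ofHV`-images is adjacency in the coordinate model. -/
theorem hexGraph_adj_ofHV (a b : HV) : hexGraph.Adj (ofHV a) (ofHV b) ↔ hvGraph.Adj a b := by
  rw [hexGraph_adj_iff_hvGraph_adj, toHV_ofHV, toHV_ofHV]

/-- The half-edges of `x :: L ++ [y]` are pairwise distinct when `L` is duplicate-free, `x, y ∉ L`,
and `x ≠ y` in case `L` is a single vertex. -/
theorem nodup_edges_cons_concat {V : Type*} [DecidableEq V] {L : List V} {x y : V}
    (hL : L.Nodup) (hx : x ∉ L) (hy : y ∉ L) (hne : L ≠ []) (hxy : L.length = 1 → x ≠ y) :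
    (List.zipWith (fun u w => s(u, w)) (x :: L ++ [y]) (x :: L ++ [y]).tail).Nodup := by
  obtain ⟨h, hh⟩ : ∃ h, L.head? = some h := ⟨L.head hne, List.head?_eq_some_head hne⟩
  obtain ⟨t, ht⟩ : ∃ t, L.getLast? = some t := ⟨L.getLast hne, List.getLast?_eq_some_getLast hne⟩
  have hhL : h ∈ L := List.mem_of_mem_head? hh
  have htL : t ∈ L := List.mem_of_getLast? ht
  rw [show (x :: L ++ [y]) = x :: L ++ [y] from rfl, edges_cons_concat hh ht x y]
  have hE := edges_nodup hL
  have hxe : s(x, h) ∉ List.zipWith (fun u w => s(u, w)) L L.tail := fun hm =>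
    hx (forall_mem_of_mem_edges L _ hm x (Sym2.mem_mk_left x h))
  have hye : s(t, y) ∉ List.zipWith (fun u w => s(u, w)) L L.tail := fun hm =>
    hy (forall_mem_of_mem_edges L _ hm y (Sym2.mem_mk_right t y))
  have hxy' : s(x, h) ≠ s(t, y) := by
    intro heq
    rw [Sym2.eq_iff] at heq
    rcases heq with ⟨hxt, -⟩ | ⟨hxy2, hht⟩
    · exact hx (hxt ▸ htL)
    · -- `h = t`: head = last, so `L` is a singleton
      have hlen : L.length = 1 := by
        obtain ⟨L', hL'⟩ : ∃ L', L = h :: L' := by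
          cases L with
          | nil => simp at hh
          | cons a L' => exact ⟨L', by simp only [List.head?_cons, Option.some.injEq] at hh; rw [hh]⟩
        subst hL'
        cases L' with
        | nil => rfl
        | cons b L'' =>
          exfalso
          have hlast : (h :: b :: L'').getLast (by simp) = t := by
            rw [List.getLast?_eq_some_getLast (by simp), Option.some.injEq] at ht; exact ht
          have hmem : t ∈ b :: L'' := by
            rw [List.getLast_cons (by simp)] at hlast
            exact hlast ▸ List.getLast_mem _
          exact (List.nodup_cons.1 hL).1 (hht ▸ hmem)
      exact hxy hlen hxy2
  rw [List.nodup_append]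
  refine ⟨List.nodup_cons.2 ⟨hxe, hE⟩, List.nodup_singleton _, ?_⟩
  intro e he e' he'
  rw [List.mem_singleton] at he'
  subst he'
  rcases List.mem_cons.1 he with rfl | he
  · exact hxy'
  · exact fun h' => hye (h' ▸ he)

/-- No backtracking in `ob :: P ++ [om]` under the side conditions of `exists_walk`. -/
theorem ne_of_validWalk {ΩHV : Finset HV} {ob om : HV} {P : List HV}
    (h : (P ≠ [] ∧ P.Nodup ∧ (ob :: (P ++ [om])).IsChain hvGraph.Adj ∧ (∀ w ∈ P, w ∈ ΩHV) ∧
      ob ∉ ΩHV ∧ om ∉ ΩHV ∧ (P.length = 1 → ob ≠ om))) :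
    ∀ (i : ℕ) (hi : i + 2 < (ob :: (P ++ [om])).length),
      (ob :: (P ++ [om]))[i] ≠ (ob :: (P ++ [om]))[i + 2]'hi := by
  obtain ⟨hne, hnd, -, hsub, hob, hom, h1⟩ := h
  have hobnot : ob ∉ P := fun hm => hob (hsub _ hm)
  have homnot : om ∉ P := fun hm => hom (hsub _ hm)
  have hd : (ob :: P).Nodup := List.nodup_cons.2 ⟨hobnot, hnd⟩
  have ht : (P ++ [om]).Nodup := by
    rw [List.nodup_append]
    refine ⟨hnd, List.nodup_singleton _, fun x hx y hy => ?_⟩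
    rw [List.mem_singleton] at hy
    subst hy
    exact fun hxy => homnot (hxy ▸ hx)
  intro i hi
  have hlen : (ob :: (P ++ [om])).length = P.length + 2 := by simp
  by_cases h2 : i + 2 < P.length + 1
  · have e1 : (ob :: (P ++ [om]))[i] = (ob :: P)[i]'(by simp; omega) := by
      show ((ob :: P) ++ [om])[i]'(by simp; omega) = _
      exact List.getElem_append_left (by simp; omega)
    have e2 : (ob :: (P ++ [om]))[i + 2]'hi = (ob :: P)[i + 2]'(by simp; omega) := by
      show ((ob :: P) ++ [om])[i + 2]'(by simp; omega) = _
      exact List.getElem_append_left (by simp; omega)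
    rw [e1, e2]
    intro heq
    have := (hd.getElem_inj_iff).1 heq
    omega
  · by_cases hi0 : i = 0
    · subst hi0
      have hP1 : P.length = 1 := by
        have := List.length_pos_of_ne_nil hne
        rw [hlen] at hi; omega
      obtain ⟨p, hp⟩ : ∃ p, P = [p] := List.length_eq_one_iff.1 hP1
      subst hp
      simpa using h1 rfl
    · obtain ⟨j, rfl⟩ : ∃ j, i = j + 1 := ⟨i - 1, by omega⟩
      have e1 : (ob :: (P ++ [om]))[j + 1] = (P ++ [om])[j]'(by simp; rw [hlen] at hi; omega) :=
        List.getElem_cons_succ ..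
      have e2 : (ob :: (P ++ [om]))[j + 1 + 2]'hi =
          (P ++ [om])[j + 2]'(by simp; rw [hlen] at hi; omega) :=
        List.getElem_cons_succ ..
      rw [e1, e2]
      intro heq
      have := (ht.getElem_inj_iff).1 heq
      omega

/-- **Explicit walks from coordinate data.** If the coordinate image of `Ω` is `ΩHV` and
`(ob, P, om)` is valid, there is a self-avoiding walk of `Ω` from the mid-edge `{ob, head P}` to the
mid-edge `{last P, om}` with vertex list `P` whose winding is `(π/3) · pturn (ob :: P ++ [om])`. -/
theorem exists_walk {Ω : Finset HexVertex} {ΩHV : Finset HV} (hΩ : ∀ f, f ∈ Ω ↔ toHV f ∈ ΩHV)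
    {ob om : HV} {P : List HV}
    (h : (P ≠ [] ∧ P.Nodup ∧ (ob :: (P ++ [om])).IsChain hvGraph.Adj ∧ (∀ w ∈ P, w ∈ ΩHV) ∧
      ob ∉ ΩHV ∧ om ∉ ΩHV ∧ (P.length = 1 → ob ≠ om))) (hP : P ≠ []) :
    ∃ γ : HexMidEdgeSAW Ω s(ofHV ob, ofHV (P.head hP)) s(ofHV (P.getLast hP), ofHV om),
      γ.verts = P.map ofHV ∧
        γ.winding = Real.pi / 3 * (HV.pturn (ob :: (P ++ [om])) : ℝ) := by
  obtain ⟨-, hnd, hch, hsub, hob, hom, h1⟩ := id h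
  have hmemΩ : ∀ w : HV, ofHV w ∈ Ω ↔ w ∈ ΩHV := fun w => by rw [hΩ, toHV_ofHV]
  have hobΩ : ofHV ob ∉ Ω := fun hh => hob ((hmemΩ ob).1 hh)
  have homΩ : ofHV om ∉ Ω := fun hh => hom ((hmemΩ om).1 hh)
  -- the chain splits as `ob ∼ head P`, the chain `P`, `last P ∼ om`
  have hchP : P.IsChain hvGraph.Adj := (List.isChain_cons.1 hch).2.left_of_append
  have hobP : hvGraph.Adj ob (P.head hP) := by
    have := (List.isChain_cons.1 hch).1 (P.head hP)
    apply this
    rw [List.head?_append, List.head?_eq_some_head hP]; rfl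
  have hPom : hvGraph.Adj (P.getLast hP) om := by
    have := (List.isChain_cons.1 hch).2.rel_getLast_head_of_append hP (by simp)
    simpa using this
  have hmapne : P.map ofHV ≠ [] := by simpa using hP
  set a : Sym2 HexVertex := s(ofHV ob, ofHV (P.head hP)) with ha
  set z : Sym2 HexVertex := s(ofHV (P.getLast hP), ofHV om) with hz
  have hobnot : ob ∉ P := fun hm => hob (hsub _ hm)
  have homnot : om ∉ P := fun hm => hom (hsub _ hm)
  have hhead : (P.map ofHV).head? = some (ofHV (P.head hP)) := by
    rw [List.head?_map, List.head?_eq_some_head hP]; rfl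
  have hlast' : (P.map ofHV).getLast? = some (ofHV (P.getLast hP)) := by
    rw [List.getLast?_map, List.getLast?_eq_some_getLast hP]; rfl
  let γ : HexMidEdgeSAW Ω a z :=
    { verts := P.map ofHV
      subset := fun v hv => by
        obtain ⟨w, hw, rfl⟩ := List.mem_map.1 hv
        exact (hmemΩ w).2 (hsub w hw)
      nodup := hnd.map ofHV_injective
      isChain := List.isChain_map_of_isChain ofHV (fun a b hab => (hexGraph_adj_ofHV a b).2 hab) hchP
      head_mem := fun v hv => by
        rw [List.head?_map, List.head?_eq_some_head hP, Option.map_some, Option.some.injEq] at hv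
        rw [← hv]; exact Sym2.mem_mk_right _ _
      getLast_mem := fun v hv => by
        rw [List.getLast?_map, List.getLast?_eq_some_getLast hP, Option.map_some,
          Option.some.injEq] at hv
        rw [← hv]; exact Sym2.mem_mk_left _ _
      eq_of_nil := fun hnil => absurd hnil hmapne
      edges_nodup := fun _ => by
        have e1 : (a :: List.zipWith (fun u w => s(u, w)) (P.map ofHV) (P.map ofHV).tail ++ [z]) =
            List.zipWith (fun u w => s(u, w)) (ofHV ob :: P.map ofHV ++ [ofHV om])
              (ofHV ob :: P.map ofHV ++ [ofHV om]).tail := by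
          rw [ha, hz, edges_cons_concat hhead hlast' (ofHV ob) (ofHV om)]
        rw [e1]
        refine nodup_edges_cons_concat (hnd.map ofHV_injective) ?_ ?_ hmapne ?_
        · exact fun hm => hobnot (by simpa [List.mem_map, ofHV_injective.eq_iff] using hm)
        · exact fun hm => homnot (by simpa [List.mem_map, ofHV_injective.eq_iff] using hm)
        · intro hl heq
          exact h1 (by simpa using hl) (ofHV_injective heq)
      fst_mem := by
        refine ⟨(SimpleGraph.mem_edgeSet hexGraph).2 ((hexGraph_adj_ofHV _ _).2 hobP),
          ofHV (P.head hP), Sym2.mem_mk_right _ _, (hmemΩ _).2 (hsub _ (List.head_mem hP))⟩ }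
  refine ⟨γ, rfl, ?_⟩
  -- the winding
  have hne : γ.verts ≠ [] := hmapne
  have hlast : γ.verts.getLast hne = ofHV (P.getLast hP) := by
    show (P.map ofHV).getLast hmapne = ofHV (P.getLast hP)
    rw [List.getLast_map]
  rw [γ.winding_eq_winding_map ha hobΩ hne (e := ofHV om) (Or.inl ⟨hlast, rfl⟩)]
  have hlist : (ofHV ob :: (γ.verts ++ [ofHV om])).map hexCenter =
      ((ob :: (P ++ [om])).map fun w => HV.emb (HV.pos w)).map fun zz => (1 / 3 : ℂ) * zz + 0 := by
    show (ofHV ob :: (P.map ofHV ++ [ofHV om])).map hexCenter = _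
    simp only [List.map_cons, List.map_append, List.map_map, List.map_nil]
    have key : ∀ w : HV, hexCenter (ofHV w) = (1 / 3 : ℂ) * HV.emb (HV.pos w) + 0 := by
      intro w
      have e := HV.emb_pos_toHV (ofHV w)
      rw [toHV_ofHV] at e
      rw [e]; ring
    simp only [key, Function.comp_def]
  rw [hlist, winding_map_affine (by norm_num) 0, HV.winding_map_emb_pos _ hch (ne_of_validWalk h)]

end Summit.CriticalPhenomena.SAWScalingLimit.Theorems.NoFoldBound.Negative.BoundaryRay
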